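/-
Origin: expansion seat `planner-pub-hodgecm-qw8b-g6-0`, handover NEW (additive leaf) ; after RUN-28 rows t28 l.29 (qw8b-g5 PohlmannAllNoN4 v2 e586c109 -> HodgeCM/Proofs/Pohlmann/PohlmannAllNoN4.lean) and qw8b-g6 #1 (Qw8NoN3 d9524ee5 -> HodgeCM/StubTree/Qw8NoN3.lean) (`HOME/pub-hodgecm-qw8b-g6/lean/Qw8b6/PohlmannAllNoN3.lean`, md5 3abbb2af, 326 lines);
landed by the gen-8 packager in gate run 29 as `HodgeCM/Proofs/Pohlmann/PohlmannAllNoN3.lean` (verbatim).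
-/
/-
Copyright: pub-hodgecm formalisation cell (harness21, 2026). New file (not vendored).
Origin: HOME/pub-hodgecm-qw8b-g6/lean/Qw8b6/PohlmannAllNoN3.lean — session planner-pub-hodgecm-qw8b-g6-0 (unit pub-hodgecm-qw8b-g6,
QW8 SEAT 2, part (6b)(ii), generation 6), third file.  WIP module `Qw8b6.PohlmannAllNoN3`; intended final place
`HodgeCM/Proofs/Pohlmann/PohlmannAllNoN3.lean` (module `HodgeCM.Proofs.Pohlmann.PohlmannAllNoN3`).  ADDITIVE LEAF: replaces
nothing, nothing imports it.  Imports are FINAL package names (both landed in gate run 28: `HodgeCM.Proofs.Pohlmann.PohlmannAllNoN4`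
= qw8b-g5 v2, `HodgeCM.StubTree.Qw8NoN3` = this seat's HANDOVER #1); nothing to rewrite.
-/
import Summits.HodgeConjecture.HodgeCM.Proofs.Pohlmann.PohlmannAllNoN4
import Summits.HodgeConjecture.HodgeCM.StubTree.Qw8NoN3

/-!
# Pohlmann's theorem in all degrees, M29 and M30, without N3 `Fact_pull_H0` (and without N4)

`HodgeCM.Proofs.Pohlmann.PohlmannAllNoN4` (qw8b-g5) removed N4 `Fact_hodge_F0` from the Pohlmann lane's all-degree
statements, leaving `ModelAxioms` + N1 + N2 + N3 + `CMProdConnected` (`dim_ℚ H⁰(A′) = 1`, itself a theorem of F-H0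
`Fact_unitH0`).  As in `HodgeCM.StubTree.Qw8NoN3`, every use of N3 on this lane is `U.pull Ma 0 = id` for a factor-wise CM
multiplication `Ma` of a CM product (`weightSpace_zero_eq_bot`, `weightSpace_empty_zero_eq_top`, `isWeightVector_zero`,
`pohlmannSpanCMAt_zero_of_pull_H0`, and M29 `weightSpan_of_facts`), i.e. an instance of `Universe.Fact_pull_H0_cmProd`, which
F-H0 implies (`fact_pull_H0_cmProd_of_unitH0`).  Re-threading:

* §1 degree-`0` weight spaces from `Fact_pull_H0_cmProd`: `weightSpace_zero_eq_bot₄`, `weightSpace_empty_zero_eq_top₄`,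
  `finrank_weightSpace_zero₄`, `finrank_weightSpace_all₄` (weight spaces are lines in EVERY degree, from `ModelAxioms` + N1 +
  `Fact_pull_H0_cmProd` + `CMProdConnected`);
* §2 M30 `Fact_weightHodge` in ALL degrees: `weightSpace_le_piece_zero_of_connected₄`, `weightHodge_of_connected₄`,
  **`weightHodge_of_unitH0₄ (M) (hN1) (hN2) (hu) : U.Fact_weightHodge`** (M30 from `ModelAxioms` + N1 + N2 + F-H0);
* §3 the span theorem for an ARBITRARY CM field: `pohlmannSpanCMAt_zero₄`, `pohlmannSpanCM_of_facts₄`,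
  **`pohlmannSpanCM_of_unitH0 (M) (hN1) (hN2) (hu) : U.PohlmannSpanCM`**;
* §4 Gao–Ullmo Thm 3.1 "(Pohlmann)" (basis + dimension count): `p ≥ 1` any CM field `pohlmannTheorem31CM_of_facts₄` /
  Galois `pohlmannTheorem31_of_facts₄` (from `ModelAxioms` + N1 + N2 + `Fact_pull_H0_cmProd`); every `p ≥ 0`:
  `pohlmannBasis_of_connected₄`, `pohlmannBasisCM_of_connected₄`, `pohlmannTheorem31AllCM_of_connected₄`,
  `pohlmannTheorem31All_of_connected₄`, `pohlmannTheorem31All_of_connectedGalois₄` and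
  **`pohlmannTheorem31All_of_unitH0₄ (M) (hN1) (hN2) (hu) : U.PohlmannTheorem31All`** /
  `pohlmannTheorem31AllCM_of_unitH0₄` — Pohlmann's theorem in all degrees from `ModelAxioms` + N1 + N2 + F-H0: no N3, no N4;
* §5 **`Assembly.COR_CM_and_pohlmannAll_of_descentFactsB₄`**: COR-CM AND Thm 3.1 in all degrees from the TEN binders of
  `Assembly.COR_CM_of_descentFactsB₄` (compare `COR_CM_and_pohlmannAll_of_descentFactsB₃`, eleven).

The proofs are those of `DegreeZero.lean` / `AnyCMFieldNoN4.lean` / `PohlmannAllNoN4.lean` verbatim with `hN3 _ Ma` ↦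
`h3 F n Θ Ma` and `weightSpan_of_facts M hN1 hN3` ↦ `weightSpan_of_facts₄ M hN1 h3`.  Nothing cited, nothing posited; no
landed declaration is restated (all names new, suffixed `₄` / `_unitH0`).
-/

noncomputable section

open scoped TensorProduct NumberField

namespace HodgeCM

namespace Universe

open Literature.AlgebraicGeometry.Motives (CMType HodgeStructure)
open Literature.AlgebraicGeometry.Motives.HodgeStructure (ofRat ofRat_apply complexConj_top piece_of_add_eq)
open HodgeCM.Pohlmann HodgeCM.GaoUllmo HodgeCM.CMTypeOps

variable {U : Universe}

/-! ## 1. Degree-`0` weight spaces from N3 at CM products -/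

section DegreeZero

variable {F : CMField} {n : ℕ} {Θ : Fin (n + 1) → CMType F}

/-- In degree `0` a weight with a nonempty component has no nonzero weight vector (compare `weightSpace_zero_eq_bot (M) (hN3)`:
the proof verbatim, N3 instantiated at the CM product only). -/
theorem weightSpace_zero_eq_bot₄ (M : U.ModelAxioms) (h3 : U.Fact_pull_H0_cmProd)
    {S : Fin (n + 1) → Finset ((F : Type) →+* ℂ)} {j₀ : Fin (n + 1)} (hj₀ : (S j₀).Nonempty) :
    U.weightSpace F Θ S 0 = ⊥ := by
  rw [eq_bot_iff]
  intro z hz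
  obtain ⟨Ma, hMa⟩ := exists_isFactorAct M F Θ j₀ 2
  have h1 := (mem_weightSpace_iff _ _ _ _ _).1 hz j₀ _ Ma hMa
  have h2 : U.pullC Ma 0 z = z := by
    show (U.pull Ma 0).baseChange ℂ z = z
    rw [h3 F n Θ Ma, LinearMap.baseChange_id]
    rfl
  have h3' : (∏ s ∈ S j₀, s ((2 : 𝓞 F) : F)) = (2 : ℂ) ^ (S j₀).card := by
    rw [← Finset.prod_const]
    refine Finset.prod_congr rfl fun s _ => ?_
    rw [NumberField.RingOfIntegers.coe_eq_algebraMap, map_ofNat, map_ofNat]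
  rw [h2, h3'] at h1
  have hm : (2 : ℂ) ^ (S j₀).card ≠ 1 := by
    have hc : (S j₀).card ≠ 0 := Finset.card_ne_zero.2 hj₀
    exact_mod_cast (Nat.one_lt_two_pow_iff.2 hc).ne'
  have h4 : ((2 : ℂ) ^ (S j₀).card - 1) • z = 0 := by rw [sub_smul, one_smul, ← h1, sub_self]
  rw [Submodule.mem_bot]
  exact (smul_eq_zero.1 h4).resolve_left (sub_ne_zero.2 hm)

/-- `V_{(∅)_j} = H⁰(A′, ℂ)` in degree `0` (compare `weightSpace_empty_zero_eq_top (hN3)`). -/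
theorem weightSpace_empty_zero_eq_top₄ (h3 : U.Fact_pull_H0_cmProd) :
    U.weightSpace F Θ (fun _ => ∅) 0 = ⊤ :=
  eq_top_iff.2 fun y _ => (mem_weightSpace_iff _ _ _ _ _).2 (isWeightVector_zero₄ h3 y)

/-- Degree `0`: `dim_ℂ V_S = 1` if `S = (∅)_j` and `0` otherwise (compare `finrank_weightSpace_zero (M) (hN3) (h0)`). -/
theorem finrank_weightSpace_zero₄ (M : U.ModelAxioms) (h3 : U.Fact_pull_H0_cmProd) (h0 : U.CMProdConnected)
    (S : Fin (n + 1) → Finset ((F : Type) →+* ℂ)) :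
    Module.finrank ℂ (U.weightSpace F Θ S 0) = if (∑ j, (S j).card) = 0 then 1 else 0 := by
  by_cases hS : ∀ j, S j = ∅
  · have hc : (∑ j, (S j).card) = 0 := Finset.sum_eq_zero fun j _ => by rw [hS j, Finset.card_empty]
    have hS' : S = fun _ => ∅ := funext hS
    rw [if_pos hc, hS', weightSpace_empty_zero_eq_top₄ h3, finrank_top, Module.finrank_baseChange, h0 F n Θ]
  · obtain ⟨j₀, hj₀⟩ := not_forall.1 hS
    have hne : (S j₀).Nonempty := Finset.nonempty_iff_ne_empty.2 hj₀
    rw [weightSpace_zero_eq_bot₄ M h3 hne, finrank_bot, if_neg]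
    intro h
    exact hne.card_pos.ne' ((Finset.sum_eq_zero_iff.1 h) j₀ (Finset.mem_univ _))

/-- **Weight spaces are lines, in every degree**, from `ModelAxioms` + N1 + N3-at-CM-products + `CMProdConnected` (compare
`finrank_weightSpace_all (M) (hN1) (hN3) (h0)`). -/
theorem finrank_weightSpace_all₄ (M : U.ModelAxioms) (hN1 : U.Fact_cupExterior) (h3 : U.Fact_pull_H0_cmProd)
    (h0 : U.CMProdConnected) (m : ℕ) (S : Fin (n + 1) → Finset ((F : Type) →+* ℂ)) :
    Module.finrank ℂ (U.weightSpace F Θ S m) = if (∑ j, (S j).card) = m then 1 else 0 := by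
  rcases Nat.eq_zero_or_pos m with rfl | hm
  · exact finrank_weightSpace_zero₄ M h3 h0 S
  · exact finrank_weightSpace M hN1 hm S

end DegreeZero

/-! ## 2. M30 `Fact_weightHodge` in all degrees without N3 -/

section CM

variable {F : CMField} {n : ℕ} {Θ : Fin (n + 1) → CMType F}

/-- M30 in degree zero from N3-at-CM-products + `CMProdConnected` (compare `weightSpace_le_piece_zero_of_connected (M) (hN3)
(h0)`). -/
theorem weightSpace_le_piece_zero_of_connected₄ (M : U.ModelAxioms) (h3 : U.Fact_pull_H0_cmProd)
    (h0 : U.CMProdConnected) (S : Fin (n + 1) → Finset ((F : Type) →+* ℂ)) :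
    U.weightSpace F Θ S 0 ≤ (U.hodge (U.cmProd F Θ) 0).piece
      (∑ j, ∑ s ∈ S j, ind (Θ j) s) (∑ j, ∑ s ∈ S j, (1 - ind (Θ j) s)) := by
  intro z hz
  by_cases hS : ∀ j, S j = ∅
  · obtain rfl : S = fun _ => ∅ := funext hS
    simp only [Finset.sum_empty, Finset.sum_const_zero]
    rw [piece_of_add_eq _ (by simp), hodge_F_zero_H0_cmProd_of_connected h0 F n Θ, complexConj_top]
    exact Submodule.mem_inf.2 ⟨trivial, trivial⟩
  · simp only [not_forall] at hS
    obtain ⟨j₀, hj₀⟩ := hS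
    rw [weightSpace_zero_eq_bot₄ M h3 (Θ := Θ) (Finset.nonempty_iff_ne_empty.2 hj₀)] at hz
    rw [(Submodule.mem_bot ℂ).1 hz]
    exact zero_mem _

end CM

/-- `Fact_weightHodgeAt 0` from `ModelAxioms` + N3-at-CM-products + `CMProdConnected`. -/
theorem weightHodgeAt_zero_of_connected₄ (M : U.ModelAxioms) (h3 : U.Fact_pull_H0_cmProd) (h0 : U.CMProdConnected) :
    U.Fact_weightHodgeAt 0 :=
  fun _ _ _ S => weightSpace_le_piece_zero_of_connected₄ M h3 h0 S

/-- **M30 `Fact_weightHodge` in ALL degrees from `ModelAxioms` + N1 + N2 + N3-at-CM-products + `CMProdConnected`** (compare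
`weightHodge_of_connected (M) (hN1) (hN2) (hN3) (h0)`). -/
theorem weightHodge_of_connected₄ (M : U.ModelAxioms) (hN1 : U.Fact_cupExterior) (hN2 : U.Fact_cup_hodge)
    (h3 : U.Fact_pull_H0_cmProd) (h0 : U.CMProdConnected) : U.Fact_weightHodge := by
  rw [weightHodge_iff_forall_weightHodgeAt]
  intro k
  cases k with
  | zero => exact weightHodgeAt_zero_of_connected₄ M h3 h0
  | succ k => exact weightHodgeAt_succ_of_facts M hN1 hN2 k

/-- **M30 in all degrees from `ModelAxioms` + N1 + N2 + F-H0 `Fact_unitH0`** — no N3, no N4. -/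
theorem weightHodge_of_unitH0₄ (M : U.ModelAxioms) (hN1 : U.Fact_cupExterior) (hN2 : U.Fact_cup_hodge)
    (hu : U.Fact_unitH0) : U.Fact_weightHodge :=
  weightHodge_of_connected₄ M hN1 hN2 (fact_pull_H0_cmProd_of_unitH0 hu) (cmProdConnected_of_unitH0 M hu)

/-! ## 3. The span theorem for an arbitrary CM field without N3 -/

/-- The level-`0` span inclusion, any CM field, from N3 at CM products (compare `pohlmannSpanCMAt_zero_of_pull_H0 (hN3)`). -/
theorem pohlmannSpanCMAt_zero₄ (h3 : U.Fact_pull_H0_cmProd) (F : CMField) (n : ℕ) (Θ : Fin (n + 1) → CMType F) :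
    (U.hodgeClassesOf (U.cmProd F Θ) 0).map ofRat ≤
      (Submodule.span ℂ {x : U.CohC (U.cmProd F Θ) (2 * 0) |
          ∃ S : Fin (n + 1) → Finset ((F : Type) →+* ℂ),
            IsHodgeWeightC Θ 0 S ∧ U.IsWeightVector F Θ S (2 * 0) x}).restrictScalars ℚ := by
  rintro y -
  rw [Submodule.restrictScalars_mem]
  refine Submodule.subset_span ⟨fun _ => ∅, ⟨by simp, fun σ => by simp⟩, fun j a Ma _ => ?_⟩
  rw [Finset.prod_empty, one_smul]
  have h : U.pull Ma (2 * 0) = LinearMap.id := h3 F n Θ Ma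
  show (U.pull Ma (2 * 0)).baseChange ℂ y = y
  rw [h, LinearMap.baseChange_id]
  rfl

/-- **Pohlmann's span theorem for an ARBITRARY CM field from `ModelAxioms` + N1 + N2 + N3-at-CM-products** (compare
`pohlmannSpanCM_of_facts₃ (M) (hN1) (hN2) (hN3)`). -/
theorem pohlmannSpanCM_of_facts₄ (M : U.ModelAxioms) (hN1 : U.Fact_cupExterior) (hN2 : U.Fact_cup_hodge)
    (h3 : U.Fact_pull_H0_cmProd) : U.PohlmannSpanCM := by
  intro F n Θ p
  cases p with
  | zero => exact pohlmannSpanCMAt_zero₄ h3 F n Θ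
  | succ q =>
    exact pohlmannSpanCMAt_of_weightHodgeAt M (weightSpan_of_facts₄ M hN1 h3) (q + 1)
      (weightHodgeAt_of_facts_of_pos M hN1 hN2 (by omega)) F n Θ

/-- **`PohlmannSpanCM` (any CM field) from `ModelAxioms` + N1 + N2 + F-H0** — no N3, no N4, no `IsGalois ℚ F`. -/
theorem pohlmannSpanCM_of_unitH0 (M : U.ModelAxioms) (hN1 : U.Fact_cupExterior) (hN2 : U.Fact_cup_hodge)
    (hu : U.Fact_unitH0) : U.PohlmannSpanCM :=
  pohlmannSpanCM_of_facts₄ M hN1 hN2 (fact_pull_H0_cmProd_of_unitH0 hu)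

/-! ## 4. Gao–Ullmo Thm 3.1 "(Pohlmann)" without N3 -/

section AnyF

variable {F : CMField} {n : ℕ} {Θ : Fin (n + 1) → CMType F}

/-- `B^p ⊗ ℂ = ⨆_{S : IsHodgeWeightC} V_S` for `p ≥ 1`, any CM field, from `ModelAxioms` + N1 + N2 + N3-at-CM-products
(compare `baseChange_hodgeClassesOf_eq_iSupC_of_pos (M) (hN1) (hN2) (hN3)`). -/
theorem baseChange_hodgeClassesOf_eq_iSupC_of_pos₄ (M : U.ModelAxioms) (hN1 : U.Fact_cupExterior)
    (hN2 : U.Fact_cup_hodge) (h3 : U.Fact_pull_H0_cmProd) {p : ℕ} (hp : 0 < p) :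
    (U.hodgeClassesOf (U.cmProd F Θ) p).baseChange ℂ =
      ⨆ (S : Fin (n + 1) → Finset ((F : Type) →+* ℂ)) (_ : IsHodgeWeightC Θ p S), U.weightSpace F Θ S (2 * p) := by
  obtain ⟨j, a, c, hinj⟩ := exists_separating_family (F := (F : Type)) n
  choose Mi hMi using fun i => exists_isFactorAct M F Θ (j i) (a i)
  have hinj' : Function.Injective (sepVal j a c) := hinj
  exact baseChange_hodgeClassesOf_eq_iSupC_of_weightHodgeAt M (weightSpan_of_facts₄ M hN1 h3) p
    (weightHodgeAt_of_facts_of_pos M hN1 hN2 (by omega)) hMi hinj'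

/-- Thm 3.1, first sentence, at `p = 0`, from `dim_ℚ H⁰(A′) = 1` and N3 at CM products (compare
`exists_basis_hodgeClassesOf_zero_of_finrank₃ (hN3)`). -/
theorem exists_basis_hodgeClassesOf_zero_of_finrank₄ (h3 : U.Fact_pull_H0_cmProd)
    (h0 : Module.finrank ℚ (U.Coh (U.cmProd F Θ) 0) = 1) :
    ∃ b : Module.Basis {S : Fin (n + 1) → Finset ((F : Type) →+* ℂ) // IsHodgeWeight Θ 0 S} ℂ
        ↥((U.hodgeClassesOf (U.cmProd F Θ) 0).baseChange ℂ),
      ∀ S, ((b S : ↥((U.hodgeClassesOf (U.cmProd F Θ) 0).baseChange ℂ)) : U.CohC (U.cmProd F Θ) (2 * 0)) ∈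
        U.weightSpace F Θ S.1 (2 * 0) := by
  obtain ⟨hU⟩ := nonempty_unique_isHodgeWeight_zero Θ
  refine ⟨Module.basisUnique _ (finrank_baseChange_hodgeClassesOf_zero₃ h0), fun S => ?_⟩
  have hS : S.1 = fun _ => ∅ := (isHodgeWeight_zero_iff S.1).1 S.2
  rw [hS]
  show _ ∈ U.weightSpace F Θ (fun _ => ∅) 0
  rw [weightSpace_empty_zero_eq_top₄ h3]
  exact Submodule.mem_top

end AnyF

/-- **Thm 3.1, both sentences, `p ≥ 1`, ANY CM field, from `ModelAxioms` + N1 + N2 + N3-at-CM-products** (compare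
`pohlmannTheorem31CM_of_facts₃ (M) (hN1) (hN2) (hN3)`). -/
theorem pohlmannTheorem31CM_of_facts₄ (M : U.ModelAxioms) (hN1 : U.Fact_cupExterior) (hN2 : U.Fact_cup_hodge)
    (h3 : U.Fact_pull_H0_cmProd) : U.PohlmannTheorem31CM := fun F n Θ p hp => by
  have hl : ∀ S : Fin (n + 1) → Finset ((F : Type) →+* ℂ), IsHodgeWeightC Θ p S →
      Module.finrank ℂ (U.weightSpace F Θ S (2 * p)) = 1 := fun S hS => by
    rw [finrank_weightSpace M hN1 (by omega) S, if_pos hS.1]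
  obtain ⟨b, hb⟩ := exists_basis_hodgeClassesOf_C_of_eq (F := F) (n := n) (Θ := Θ) M p
    (baseChange_hodgeClassesOf_eq_iSupC_of_pos₄ M hN1 hN2 h3 hp) hl
  refine ⟨⟨b, hb⟩, ?_⟩
  rw [← Module.finrank_eq_nat_card_basis b,
    ← (Submodule.toBaseChange.toLinearEquiv ℂ (U.hodgeClassesOf (U.cmProd F Θ) p)).finrank_eq,
    Module.finrank_baseChange]

/-- … the Galois statement `PohlmannTheorem31` (`p ≥ 1`) from `ModelAxioms` + N1 + N2 + N3-at-CM-products. -/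
theorem pohlmannTheorem31_of_facts₄ (M : U.ModelAxioms) (hN1 : U.Fact_cupExterior) (hN2 : U.Fact_cup_hodge)
    (h3 : U.Fact_pull_H0_cmProd) : U.PohlmannTheorem31 :=
  pohlmannTheorem31_of_pohlmannTheorem31CM (pohlmannTheorem31CM_of_facts₄ M hN1 hN2 h3)

/-- `PohlmannBasis` (every `p ≥ 0`, Galois `F`) from `ModelAxioms` + N1 + N2 + N3-at-CM-products + `CMProdConnected`. -/
theorem pohlmannBasis_of_connected₄ (M : U.ModelAxioms) (hN1 : U.Fact_cupExterior) (hN2 : U.Fact_cup_hodge)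
    (h3 : U.Fact_pull_H0_cmProd) (h0 : U.CMProdConnected) : U.PohlmannBasis :=
  pohlmannBasis_holds M (weightSpan_of_facts₄ M hN1 h3) (weightHodge_of_connected₄ M hN1 hN2 h3 h0)

/-- `PohlmannBasisCM` (every `p ≥ 0`, any CM field) from the same list. -/
theorem pohlmannBasisCM_of_connected₄ (M : U.ModelAxioms) (hN1 : U.Fact_cupExterior) (hN2 : U.Fact_cup_hodge)
    (h3 : U.Fact_pull_H0_cmProd) (h0 : U.CMProdConnected) : U.PohlmannBasisCM :=
  pohlmannBasisCM_holds M (weightSpan_of_facts₄ M hN1 h3) (weightHodge_of_connected₄ M hN1 hN2 h3 h0)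

/-- **Thm 3.1, both sentences, EVERY `p ≥ 0`, ANY CM field, from `ModelAxioms` + N1 + N2 + N3-at-CM-products +
`CMProdConnected`** (compare `pohlmannTheorem31AllCM_of_connected₃`). -/
theorem pohlmannTheorem31AllCM_of_connected₄ (M : U.ModelAxioms) (hN1 : U.Fact_cupExterior) (hN2 : U.Fact_cup_hodge)
    (h3 : U.Fact_pull_H0_cmProd) (h0 : U.CMProdConnected) : U.PohlmannTheorem31AllCM := fun F n Θ p => by
  have hl : ∀ S : Fin (n + 1) → Finset ((F : Type) →+* ℂ), IsHodgeWeightC Θ p S →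
      Module.finrank ℂ (U.weightSpace F Θ S (2 * p)) = 1 := fun S hS => by
    rw [finrank_weightSpace_all₄ M hN1 h3 h0 (2 * p) S, if_pos hS.1]
  obtain ⟨b, hb⟩ := exists_basis_hodgeClassesOf_C_of_eq (F := F) (n := n) (Θ := Θ) M p
    (pohlmannBasisCM_of_connected₄ M hN1 hN2 h3 h0 F n Θ p) hl
  refine ⟨⟨b, hb⟩, ?_⟩
  rw [← Module.finrank_eq_nat_card_basis b,
    ← (Submodule.toBaseChange.toLinearEquiv ℂ (U.hodgeClassesOf (U.cmProd F Θ) p)).finrank_eq,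
    Module.finrank_baseChange]

/-- The Galois all-degree statement `PohlmannTheorem31All` from `ModelAxioms` + N1 + N2 + N3-at-CM-products +
`CMProdConnected`. -/
theorem pohlmannTheorem31All_of_connected₄ (M : U.ModelAxioms) (hN1 : U.Fact_cupExterior) (hN2 : U.Fact_cup_hodge)
    (h3 : U.Fact_pull_H0_cmProd) (h0 : U.CMProdConnected) : U.PohlmannTheorem31All :=
  pohlmannTheorem31All_of_pohlmannTheorem31AllCM (pohlmannTheorem31AllCM_of_connected₄ M hN1 hN2 h3 h0)

/-- Thm 3.1 for every `p ≥ 0` from `ModelAxioms` + N1 + N2 + N3-at-CM-products + connectedness of the GALOIS CM products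
(compare `pohlmannTheorem31All_of_connectedGalois₃`). -/
theorem pohlmannTheorem31All_of_connectedGalois₄ (M : U.ModelAxioms) (hN1 : U.Fact_cupExterior)
    (hN2 : U.Fact_cup_hodge) (h3 : U.Fact_pull_H0_cmProd) (h0 : U.CMProdConnectedGalois) :
    U.PohlmannTheorem31All := by
  intro F hG n Θ p
  cases p with
  | zero =>
    exact ⟨exists_basis_hodgeClassesOf_zero_of_finrank₄ h3 (h0 F hG n Θ),
      finrank_hodgeClassesOf_zero_of_finrank₃ (h0 F hG n Θ)⟩
  | succ q => exact pohlmannTheorem31_of_facts₄ M hN1 hN2 h3 F hG n Θ (q + 1) (Nat.succ_pos q)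

/-- **Pohlmann's theorem (Gao–Ullmo Thm 3.1, both sentences) in ALL degrees from `ModelAxioms` + N1 + N2 + F-H0
`Fact_unitH0` — no N3, no N4** (compare `pohlmannTheorem31All_of_unitH0₃ (M) (hN1) (hN2) (hN3) (hu)`). -/
theorem pohlmannTheorem31All_of_unitH0₄ (M : U.ModelAxioms) (hN1 : U.Fact_cupExterior) (hN2 : U.Fact_cup_hodge)
    (hu : U.Fact_unitH0) : U.PohlmannTheorem31All :=
  pohlmannTheorem31All_of_connected₄ M hN1 hN2 (fact_pull_H0_cmProd_of_unitH0 hu) (cmProdConnected_of_unitH0 M hu)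

/-- … any CM field, from F-H0. -/
theorem pohlmannTheorem31AllCM_of_unitH0₄ (M : U.ModelAxioms) (hN1 : U.Fact_cupExterior) (hN2 : U.Fact_cup_hodge)
    (hu : U.Fact_unitH0) : U.PohlmannTheorem31AllCM :=
  pohlmannTheorem31AllCM_of_connected₄ M hN1 hN2 (fact_pull_H0_cmProd_of_unitH0 hu) (cmProdConnected_of_unitH0 M hu)

end Universe

/-! ## 5. COR-CM and Pohlmann's theorem from the ten binders -/

namespace Assembly

/-- **COR-CM AND Pohlmann's theorem in all degrees from ONE binder list, without N3 and N4** — `ModelAxioms`,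
`RealisationExistsFace`, N1, N2, F4, F5, F-H0 `Fact_unitH0`, F7d-B `Fact_gysinDescentB`, `Fact_dimProd` (TEN binders;
compare `COR_CM_and_pohlmannAll_of_descentFactsB₃`, eleven, and qw8b-g3's `COR_CM_and_pohlmannAll_of_descentFactsB`,
twelve). -/
theorem COR_CM_and_pohlmannAll_of_descentFactsB₄ (U : Universe) (M : U.ModelAxioms)
    (hR : U.RealisationExistsFace) (hN1 : U.Fact_cupExterior) (hN2 : U.Fact_cup_hodge)
    (h4 : U.Fact_cupAlg) (h5 : U.Fact_cupAssoc) (hu : U.Fact_unitH0) (hb : U.Fact_gysinDescentB)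
    (hd : U.Fact_dimProd) : U.HC_CM ∧ U.PohlmannTheorem31All :=
  ⟨COR_CM_of_descentFactsB₄ U M hR hN1 hN2 h4 h5 hu hb hd,
    Universe.pohlmannTheorem31All_of_unitH0₄ M hN1 hN2 hu⟩

end Assembly

end HodgeCM

end
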